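import Summits.RiemannHypothesis.RiemannHypothesis.Theorems.SpectralTraceHeckeSurrogateDefs
import Literature.NumberTheory.LFunctions.WeilExplicitRightEdge
import Literature.NumberTheory.LFunctions.WeilMellinInversion
import Literature.Analysis.Complex.WeightedArgumentPrinciple
import HarnessLib

/-!
# The folded contour identity for a symmetric entire function — stub `stub_contourIdentity`

Route `RiemannHypothesis/SpectralTrace`, crux `WindowTracePrime2` (stmt-RiemannHypothesis-11196),
line `hecke-cusp-perturbation-surrogate`, registered stub **C** `stub_contourIdentity`
(skeleton `Cruxes/WindowTracePrime2/Lines/hecke_cusp_perturbation_surrogate.lean`; vocabulary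
`Theorems/SpectralTraceHeckeSurrogateDefs.lean`).

For `F` entire with `F(1-s) = F(s)`, zero-free on the closed half-plane `Re s ≥ σ` (`σ > 1/2`), and a
height `T > 0` which is not `±` the ordinate of a zero of `F`, the residue theorem with weight `ĝ`
(the tree's `Literature.Analysis.Complex.integral_boundary_rect_logDeriv_mul`) on the rectangle
`[1-σ, σ] × [-T, T]` reads
`∮ (F'/F) ĝ = 2πi Σ_{ρ ∈ (1-σ,σ)×(-T,T), F(ρ)=0} m(ρ) ĝ(ρ)`, `m(ρ) = meromorphicOrderAt F ρ`;
the left edge `Re s = 1 - σ` is folded onto the right one by `(F'/F)(1-s) = -(F'/F)(s)`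
(differentiate `F(1-s) = F(s)`), the weight becoming `k̂ = ĝ + ĝ(1-·) = (weilSymm g)^`
(`weilMellin_weilSymm`). This is verbatim the tree's `weilZeroSidePartial_eq_contour`
(`Literature/NumberTheory/LFunctions/WeilExplicitFormulaProofs.lean`, there for `ξ` on `[-1/2, 3/2]`)
for a general symmetric entire `F`; the zero sum is kept in the raw `finsum` form of the engine.

References: E. Bombieri, *Remarks on Weil's quadratic functional in the theory of prime numbers I*,
Rend. Mat. Acc. Lincei (9) 11 (2000), §2 [Bombieri2000Weil]; J. B. Conway, *Functions of One Complex
Variable I* (1978), Ch. V Thm. 3.6 [Conway1978].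
-/

noncomputable section

set_option linter.dupNamespace false

namespace Summit.RiemannHypothesis.RiemannHypothesis.Theorems.HeckeSurrogate

open Complex Filter Set MeasureTheory
open scoped Real Topology
open Literature.NumberTheory.LFunctions
open Literature.Uncategorized

/-! ## Consequences of the symmetry `F(1-s) = F(s)` -/

/-- For `F` with `F(1-s) = F(s)`: `F'(1-s) = -F'(s)` (chain rule; no differentiability needed since
`s ↦ 1 - s` is an affine involution). [folklore] -/
theorem ci_deriv_one_sub {F : ℂ → ℂ} (hsymm : ∀ s : ℂ, F (1 - s) = F s) (s : ℂ) :
    deriv F (1 - s) = -deriv F s := by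
  have hfun : (fun s : ℂ ↦ F (1 - s)) = F := funext hsymm
  have h := deriv_comp_const_sub (f := F) (a := (1 : ℂ)) (x := s)
  rw [hfun] at h
  rw [h, neg_neg]

/-- For `F` with `F(1-s) = F(s)`: `(F'/F)(1-s) = -(F'/F)(s)`. [folklore] -/
theorem ci_logDeriv_one_sub {F : ℂ → ℂ} (hsymm : ∀ s : ℂ, F (1 - s) = F s) (s : ℂ) :
    logDeriv F (1 - s) = -logDeriv F s := by
  rw [logDeriv_apply, logDeriv_apply, ci_deriv_one_sub hsymm, hsymm, neg_div]

/-- Continuity of `y ↦ (F'/F)(σ + iy)` for `F` entire and zero-free on the line `Re s = σ`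
(`F'` is entire, `F'/F` a quotient with non-vanishing denominator). [folklore] -/
theorem ci_continuous_logDeriv_vertical {F : ℂ → ℂ} (hF : Differentiable ℂ F) {σ : ℝ}
    (hne : ∀ y : ℝ, F (σ + y * I) ≠ 0) :
    Continuous fun y : ℝ ↦ logDeriv F (σ + y * I) := by
  have h1 : Continuous fun y : ℝ ↦ deriv F (σ + y * I) :=
    hF.deriv.continuous.comp (by fun_prop)
  have h2 : Continuous fun y : ℝ ↦ F (σ + y * I) := hF.continuous.comp (by fun_prop)
  simp only [logDeriv_apply]
  exact h1.div h2 hne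

/-! ## The registered stub -/

/-- **STUB C · `stub_contourIdentity`** — the weighted residue theorem for `(F'/F)·ĝ` on
`[1-σ, σ] × [-T, T]`, left edge folded onto the right one by `F(1-s) = F(s)` (`k̂ = ĝ + ĝ(1-·)`):
`2πi Σ_{ρ ∈ (1-σ,σ)×(-T,T)} m(ρ) ĝ(ρ) = ∫_bottom − ∫_top + i ∫_{-T}^{T} (F'/F)(σ+iy) k̂(σ+iy) dy`
for `F` entire, symmetric, zero-free on `Re s ≥ σ > 1/2`, `T > 0` not `±` an ordinate of a zero, `g` a
Weil test function (Bombieri §2, for `ξ`; engine: Conway V.3.6 on a rectangle,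
`Literature.Analysis.Complex.integral_boundary_rect_logDeriv_mul`). [cite: Bombieri2000Weil, §2] -/
theorem stub_contourIdentity :
    ∀ F : ℂ → ℂ, Differentiable ℂ F → (∀ s : ℂ, F (1 - s) = F s) →
      ∀ (σ T : ℝ), 1 / 2 < σ → 0 < T →
        (∀ s : ℂ, σ ≤ s.re → F s ≠ 0) →
        (∀ s : ℂ, F s = 0 → s.im ≠ T ∧ s.im ≠ -T) →
        ∀ g : ℝ → ℂ, IsWeilTest g →
          2 * π * I * ∑ᶠ ρ ∈ {ρ : ℂ | F ρ = 0 ∧ ρ ∈ Set.Ioo (1 - σ) σ ×ℂ Set.Ioo (-T) T},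
              ((meromorphicOrderAt F ρ).untop₀ : ℂ) * weilMellin g ρ =
            (∫ x : ℝ in (1 - σ)..σ, logDeriv F (x + (-T : ℝ) * I) * weilMellin g (x + (-T : ℝ) * I)) -
            (∫ x : ℝ in (1 - σ)..σ, logDeriv F (x + T * I) * weilMellin g (x + T * I)) +
            I * ∫ y : ℝ in (-T)..T, logDeriv F (σ + y * I) * weilMellin (weilSymm g) (σ + y * I) := by
  intro F hF hsymm σ T hσ hT hright hgood g hg
  have hgc : Continuous g := hg.1.continuous
  -- non-vanishing of `F` on the four edges
  have hhor : ∀ (t : ℝ), (t = T ∨ t = -T) → ∀ x : ℝ, F (x + t * I) ≠ 0 := by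
    intro t ht x h0
    have := hgood _ h0
    simp at this
    rcases ht with rfl | rfl
    · exact this.1 rfl
    · exact this.2 rfl
  have hR : ∀ y : ℝ, F (σ + y * I) ≠ 0 := fun y ↦ hright _ (by simp)
  have hL : ∀ y : ℝ, F (((1 - σ : ℝ) : ℂ) + y * I) ≠ 0 := by
    intro y
    have e : (((1 - σ : ℝ) : ℂ) + y * I) = 1 - ((σ : ℂ) + ((-y : ℝ) : ℂ) * I) := by
      push_cast; ring
    rw [e, hsymm]
    exact hR (-y)
  have key := Literature.Analysis.Complex.integral_boundary_rect_logDeriv_mul (f := F)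
    (g := weilMellin g) (a := 1 - σ) (b := σ) (c := -T) (d := T) (by linarith) (by linarith)
    (fun z _ ↦ hF.analyticAt z) (analyticOnNhd_weilMellin hgc hg.2 _)
    (fun x _ ↦ by exact_mod_cast hhor (-T) (Or.inr rfl) x) (fun x _ ↦ hhor T (Or.inl rfl) x)
    (fun y _ ↦ hL y) (fun y _ ↦ hR y)
  simp only [← logDeriv_apply] at key
  rw [← key]
  -- fold the left edge
  have hleft : (∫ y : ℝ in (-T)..T, logDeriv F (((1 - σ : ℝ) : ℂ) + y * I) *
      weilMellin g (((1 - σ : ℝ) : ℂ) + y * I)) =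
      -∫ y : ℝ in (-T)..T, logDeriv F ((σ : ℂ) + y * I) *
        weilMellin g (1 - ((σ : ℂ) + y * I)) := by
    have e : ∀ y : ℝ, (((1 - σ : ℝ) : ℂ) + y * I) = 1 - (((σ : ℂ) + ((-y : ℝ) : ℂ) * I)) := by
      intro y; push_cast; ring
    have h1 : (fun y : ℝ ↦ logDeriv F (((1 - σ : ℝ) : ℂ) + y * I) *
        weilMellin g (((1 - σ : ℝ) : ℂ) + y * I)) = fun y : ℝ ↦
        -((fun u : ℝ ↦ logDeriv F ((σ : ℂ) + u * I) *
          weilMellin g (1 - ((σ : ℂ) + u * I))) (-y)) := by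
      funext y
      simp only
      rw [e y, ci_logDeriv_one_sub hsymm]
      push_cast
      ring
    rw [h1, intervalIntegral.integral_neg, intervalIntegral.integral_comp_neg (fun u : ℝ ↦
      logDeriv F ((σ : ℂ) + u * I) * weilMellin g (1 - ((σ : ℂ) + u * I)))]
    simp
  rw [hleft]
  -- combine the two vertical pieces into `k̂`
  have hc1 : Continuous fun y : ℝ ↦ logDeriv F ((σ : ℂ) + y * I) :=
    ci_continuous_logDeriv_vertical hF hR
  have hcg : Continuous (weilMellin g) := continuous_weilMellin hgc hg.2
  have i1 : IntervalIntegrable (fun y : ℝ ↦ logDeriv F ((σ : ℂ) + y * I) *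
      weilMellin g ((σ : ℂ) + y * I)) volume (-T) T :=
    (hc1.mul (hcg.comp (by fun_prop))).intervalIntegrable _ _
  have i2 : IntervalIntegrable (fun y : ℝ ↦ logDeriv F ((σ : ℂ) + y * I) *
      weilMellin g (1 - ((σ : ℂ) + y * I))) volume (-T) T :=
    (hc1.mul (hcg.comp (by fun_prop))).intervalIntegrable _ _
  have hk : (∫ y : ℝ in (-T)..T, logDeriv F ((σ : ℂ) + y * I) *
      weilMellin (weilSymm g) ((σ : ℂ) + y * I)) =
      (∫ y : ℝ in (-T)..T, logDeriv F ((σ : ℂ) + y * I) *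
        weilMellin g ((σ : ℂ) + y * I)) +
      ∫ y : ℝ in (-T)..T, logDeriv F ((σ : ℂ) + y * I) *
        weilMellin g (1 - ((σ : ℂ) + y * I)) := by
    rw [← intervalIntegral.integral_add i1 i2]
    congr 1 with y
    rw [weilMellin_weilSymm hg]
    ring
  rw [hk]
  push_cast
  ring

end Summit.RiemannHypothesis.RiemannHypothesis.Theorems.HeckeSurrogate

end
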